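import Summits.PneNP.PneNP.Theses.ExpanderLinearGenerators
import Literature.Computability.Complexity.CookBridges
import Literature.Computability.Complexity.TautMachine
import Literature.Computability.MetaComplexity.ProofSystemsProofs

/-!
# PneNP / ExpanderLinearGenerators — the assembly `Assembly` (stmt-PneNP-15165, route rev 6)

Route `PneNP/ExpanderLinearGenerators`, item stmt-PneNP-15165 (`Assembly`, rank 1, rev 6):

  `NoPolyBoundedProofSystem → PneNP`.

The route's single deciding crux `X = NoPolyBoundedProofSystem` (no polynomially bounded
Cook–Reckhow proof system for `TAUT`; stmt-PneNP-0097) alone implies the summit statement.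

Proof (Cook–Reckhow 1979, Prop. 1.1 with Prop. 1.4; Cook, Clay problem description §1), over
conjecture-free modules only (`CookBridges`, `TautMachine`, `ProofSystemsProofs`, `Classes`), exactly
as in the deciding theorems of the sibling routes `MatroidTseitin` / `LyapunovRefutations`: if
`Classes.P = Nondeterministic.NP` then `coNP = co P = P = NP` (`co_P_holds`), so `TAUT ∈ coNP`
(`TAUT_mem_coNP_holds`) lies in `NP` and therefore has a polynomially bounded proof system
(`hasPolyBoundedProofSystem_iff_mem_NP_holds`, Cook–Reckhow Prop. 1.4) — contradicting `X`; and
`Classes.P ≠ Nondeterministic.NP` is Cook's statement `PneNP` by the model bridges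
(`pneNP_shape_of_P_ne_NP`). No named fact is taken as a hypothesis, and the file deliberately does
NOT import `Theorems/ExpanderLinearGeneratorsTautBridge` (whose cone contains `ClayProblem`,
`ClayProblemProofs`, `ProofComplexityNP` with unproved named facts): the statement is also
definitionally the proved support item `TautBridge` (after unfolding `NoPolyBoundedProofSystem`), and
equals `fun hX => closes hX tautBridge_proof`, but this proof keeps the assembly's import cone
conjecture-free. The cycle-free term form (no `Theses` import, usable as a `_holds` link) is
`Summit.PneNP.PneNP.Theorems.pneNP_of_not_hasPolyBoundedProofSystem_TAUT`
(`Theorems/ExpanderLinearGeneratorsTautBridgeTerm.lean`).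

This file is NOT `Theorems/ExpanderLinearGeneratorsAssembly.lean`: that module proves the rev ≤ 5
assembly (stmt-PneNP-10718, the 3-ary `NoPolyBoundedProofSystem → TautBridge → PneNP`, by modus
ponens) and no longer elaborates against the rev-6 route file (its `Assembly` is now 2-ary), so it
cannot be appended to.

References: S. A. Cook, R. A. Reckhow, *The relative efficiency of propositional proof systems*,
J. Symb. Logic 44 (1979), §1, Prop. 1.1 and Prop. 1.4; S. Cook, *The P versus NP problem* (Clay
Mathematics Institute, 2000), §1; S. Arora, B. Barak, *Computational Complexity: A Modern Approach*
(2009), §2.6.1.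
-/

set_option linter.dupNamespace false -- `Summit.PneNP.PneNP.…`: summit = sub-problem name (D-0017 single-conjunct layout)

namespace Summit.PneNP.PneNP.Theorems

/-- **Assembly of route ExpanderLinearGenerators, rev 6** (item stmt-PneNP-15165):
`NoPolyBoundedProofSystem → PneNP`. If `P = NP` (prelude classes) then `coNP = co P = P = NP`, so
`TAUT ∈ coNP = NP` has a polynomially bounded proof system (Cook–Reckhow 1979, Prop. 1.4),
contradicting the hypothesis; `P ≠ NP` over the prelude classes is Cook's `PneNP` by the model
bridges (`pneNP_shape_of_P_ne_NP`). [cite: CookReckhow1979, §1 Prop. 1.1] -/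
theorem expanderLinearGenerators_assembly_rev6_proof :
    Summit.PneNP.PneNP.Theses.ExpanderLinearGenerators.Assembly := by
  unfold Summit.PneNP.PneNP.Theses.ExpanderLinearGenerators.Assembly
    Summit.PneNP.PneNP.Theses.ExpanderLinearGenerators.NoPolyBoundedProofSystem
  intro hX
  have hne : Literature.Computability.Complexity.Classes.P ≠
      Literature.Computability.Complexity.Nondeterministic.NP := by
    intro hPNP
    apply hX
    have hT : Literature.Computability.Complexity.TAUT ∈ Literature.Computability.Complexity.coNP :=
      Literature.Computability.Complexity.TAUT_mem_coNP_holds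
    have hco : Literature.Computability.Complexity.coNP =
        Literature.Computability.Complexity.Nondeterministic.NP := by
      show Literature.Computability.Complexity.co
          Literature.Computability.Complexity.Nondeterministic.NP =
        Literature.Computability.Complexity.Nondeterministic.NP
      rw [← hPNP]
      exact Literature.Computability.Complexity.co_P_holds
    rw [hco] at hT
    exact Literature.Computability.MetaComplexity.hasPolyBoundedProofSystem_iff_mem_NP_holds.2 hT
  obtain ⟨L, hL, hL'⟩ := Literature.Computability.Complexity.pneNP_shape_of_P_ne_NP hne
  exact ⟨L, hL, hL'⟩

end Summit.PneNP.PneNP.Theorems
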